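/- Copyright: the b2b-balaban cell (near-miss cell 7), T⁴-continuum fan-out, NE7b swarm leaf 04 (gen 6; road W-RP, sub-row
«W3f» file 1 of 2: the half-torus geometry of a centre cut in Bałaban's `Setup` vocabulary).  Released under the
licence of the surrounding project. -/
import Literature.MathematicalPhysics.QuantumFieldTheory.Balaban1983to89.AveragingReflection

/-!
# History chessboard road: the half-torus of a CENTRE CUT at one level of Bałaban's tower (W3f, file 1)

Summits-side support leaf of the T⁴-continuum cell (rung (B)+1 on a FINITE torus only; NOT infinite volume, NOT the
mass gap, NOT the Clay statement; NOT a proof of the spine estimate NE7b).  Road W-RP (formerly W-RP-VAR; owner rulings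
R-OWNER-23-2, R-OWNER-23-8) of the swarm claim table `t4/b2b-balaban-t4-ne7b-p1/LEAVES-NE7b.md`, sub-row «W3f» (booked
v3.39 to leaf-04 g6), file 1 of 2; file 2 = `HistoryRPAveraging` (W3d's two function-level sentences for the block
averaging (0.4)).  [folklore] bookkeeping in the tree's `Setup` vocabulary (`Site`, `PBond`, `blockOf`,
`GaugeField.creflect`, `AveragingRT.crefBond`); imports `AveragingReflection` only; no `structure`, no `[cite:]` tag,
no `Prop`-valued definition (c1: the two `Finset`s and the σ-algebra below are DATA), no constant (c2∕c6), no exit ∕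
socket ∕ `HistoryConstants` file (c3); nothing printed asserted.

WHAT.
* §0 THE HALF-TORUS OF DIRECTION `ρ` AT LEVEL `j`: labels `0 ≤ n_ρ < N_j ∕ 2` (`N_j = P.sitesPerDir j = 2·L^{m+K−j}`,
  EVEN — `two_mul_half_sitesPerDir` — so the CENTRE reflection `n_ρ ↦ −n_ρ − 1` of [B12] (2.17) in the centred labels,
  tree `GaugeField.creflect ρ`, cuts BETWEEN sites at `−1 ∣ 0` and `N∕2 − 1 ∣ N∕2` and fixes no site); the positive bonds
  `posBonds` (BOTH endpoints positive — links across the cut belong to neither half, W3c's `posEdges` convention) and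
  the crossing bonds `crossBonds`; block compatibility `blockOf_pos_iff` (`N_j∕2 = L·N_{j+1}∕2` in the standing range
  `j + 1 ≤ m + K`); the centre-reflected bond `cbond` (= the tree's `AveragingRT.crefBond` one level up,
  `cbond_eq_crefBond`, available at every level), its endpoint labels (`val_cbond`), `cbond_cbond`,
  `cbond_mem_crossBonds`, `cbond_mem_posBonds`; the centre reflection of FIELDS evaluated (`creflect_apply`), an
  involution (`creflect_creflect`, `creflect_comp_self` — W3b's binder `θ ∘ θ = id`) and measurable
  (`measurable_creflect` — W3b's binder `Measurable θ`).
* §1 THE POSITIVE σ-ALGEBRA `mPos G j ρ := Filtration.piFinset posBonds` (W3c's currency), `mPos_le` (W3b's `mP ≤ m`),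
  and the criterion `measurable_mPos_of_dependsOn`: measurable + depends only on the positive bonds ⇒ `mPos`-measurable
  (`Function.updateFinset` factorisation).

HONEST: geometry∕σ-algebra bookkeeping for ONE cut per axis (the centre cut; the other block cuts are its conjugates by
block translations — sub-row W-CUTS, leaf-02 g8); discharges nothing by itself; NE7b NOT proved; spine 0∕9.  HONEST
DEPENDENCY (cell): continuum YM on T⁴ ⇐ BetaPertH ∧ nine spine estimates (0/9 proved); BetaPertH ⇐ (D1) ∧ (D4) ∧ CAP+tail;
G-an2-4 gates asym, D1 and NE2/3/4.  This file changes none of it. -/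

open MeasureTheory
open Literature.MathematicalPhysics.QuantumFieldTheory.Balaban1983to89
open AveragingRT

namespace Summit.QuantumFields.BalabanUV.T4Continuum.HistoryRPHalfTorus

noncomputable section

variable {P : Params} {j : ℕ}

/-! ## §0 The half-torus of direction `ρ` at level `j`; the centre reflection on bonds and fields -/

section Geometry

/-- `N_j ∕ 2 = L^{m+K−j}`. [folklore] -/
theorem half_sitesPerDir (P : Params) (j : ℕ) : P.sitesPerDir j / 2 = P.L ^ (P.m + P.K - j) := by
  unfold Params.sitesPerDir; omega

/-- `N_j` is even: `2 · (N_j ∕ 2) = N_j`. [folklore] -/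
theorem two_mul_half_sitesPerDir (P : Params) (j : ℕ) : 2 * (P.sitesPerDir j / 2) = P.sitesPerDir j := by
  unfold Params.sitesPerDir; omega

/-- Block compatibility of the halves: `N_j ∕ 2 = (N_{j+1} ∕ 2) · L` in the standing range. [folklore] -/
theorem half_sitesPerDir_eq_mul (hj : j + 1 ≤ P.m + P.K) :
    P.sitesPerDir j / 2 = P.sitesPerDir (j + 1) / 2 * P.L := by
  rw [half_sitesPerDir, half_sitesPerDir]
  have h : P.m + P.K - j = (P.m + P.K - (j + 1)) + 1 := by omega
  rw [h, pow_succ]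

/-- **THE POSITIVE FINE BONDS of direction `ρ`**: both endpoints carry a label `n_ρ < N_j ∕ 2` (the links of the
positive half-torus; links across the cut belong to neither half — W3c's `posEdges` convention). [folklore] -/
def posBonds (P : Params) (j : ℕ) (ρ : Fin P.d) : Finset (PBond P j) :=
  Finset.univ.filter fun b => (b.src ρ).val < P.sitesPerDir j / 2 ∧ (b.tgt ρ).val < P.sitesPerDir j / 2

/-- **THE CROSSING BONDS of direction `ρ`**: exactly one endpoint in the positive half. [folklore] -/
def crossBonds (P : Params) (j : ℕ) (ρ : Fin P.d) : Finset (PBond P j) :=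
  Finset.univ.filter fun b => ¬ ((b.src ρ).val < P.sitesPerDir j / 2 ↔ (b.tgt ρ).val < P.sitesPerDir j / 2)

/-- membership in `posBonds`. [folklore] -/
@[simp] theorem mem_posBonds {ρ : Fin P.d} {b : PBond P j} :
    b ∈ posBonds P j ρ ↔ (b.src ρ).val < P.sitesPerDir j / 2 ∧ (b.tgt ρ).val < P.sitesPerDir j / 2 := by
  simp [posBonds]

/-- membership in `crossBonds`. [folklore] -/
@[simp] theorem mem_crossBonds {ρ : Fin P.d} {b : PBond P j} :
    b ∈ crossBonds P j ρ ↔ ¬ ((b.src ρ).val < P.sitesPerDir j / 2 ↔ (b.tgt ρ).val < P.sitesPerDir j / 2) := by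
  simp [crossBonds]

/-- **POSITIVITY IS READ ON BLOCKS**: a fine site is positive iff its block is (standing range). [folklore] -/
theorem blockOf_pos_iff (hj : j + 1 ≤ P.m + P.K) (x : Site P j) (ρ : Fin P.d) :
    ((blockOf x) ρ).val < P.sitesPerDir (j + 1) / 2 ↔ (x ρ).val < P.sitesPerDir j / 2 := by
  rw [Site.val_blockOf hj, Nat.div_lt_iff_lt_mul P.L_pos, half_sitesPerDir_eq_mul hj]

/-- The label of the centre-reflected site: `N_j − 1 − n_ρ` (no wrap-around). [folklore] -/
theorem val_creflSite (ρ : Fin P.d) (x : Site P j) :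
    (((x.reflect ρ).unshift ρ) ρ).val = P.sitesPerDir j - 1 - (x ρ).val := by
  rw [Site.unshift_apply, if_pos rfl, Site.reflect_apply, if_pos rfl, AveragingReflection.val_neg_sub_one]

/-- THE CENTRE REFLECTION SWAPS THE HALVES (no fixed site: `N_j` is even). [folklore] -/
theorem pos_creflSite_iff (ρ : Fin P.d) (x : Site P j) :
    (((x.reflect ρ).unshift ρ) ρ).val < P.sitesPerDir j / 2 ↔ ¬ (x ρ).val < P.sitesPerDir j / 2 := by
  rw [val_creflSite]
  have h1 := ZMod.val_lt (x ρ)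
  have h2 := two_mul_half_sitesPerDir P j
  omega

/-- **THE CENTRE-REFLECTED BOND** `c_ρ b` (as a positively oriented bond): `PBond.reflect` followed by the translation
by `−e_ρ` — the tree's `AveragingRT.crefBond` one level up (`cbond_eq_crefBond`), available at every level. [folklore] -/
def cbond (ρ : Fin P.d) (b : PBond P j) : PBond P j := (b.reflect ρ).translate ((0 : Site P j).unshift ρ)

/-- `cbond` IS the tree's `crefBond` at a successor level. [folklore] -/
theorem cbond_eq_crefBond (ρ : Fin P.d) (c : PBond P (j + 1)) : cbond ρ c = crefBond ρ c := rfl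

/-- direction of `cbond`. [folklore] -/
@[simp] theorem cbond_dir (ρ : Fin P.d) (b : PBond P j) : (cbond ρ b).dir = b.dir := rfl

/-- the translation letter `−e_ρ`, evaluated. [folklore] -/
theorem zero_unshift_apply (ρ ν : Fin P.d) : ((0 : Site P j).unshift ρ) ν = if ν = ρ then -1 else 0 := by
  have h0 : ∀ κ : Fin P.d, (0 : Site P j) κ = 0 := fun _ => rfl
  rw [Site.unshift_apply, h0, h0, zero_sub]

/-- the `ρ`-label of the source of `cbond ρ b` is the reflected `ρ`-label of the TARGET of `b`. [folklore] -/
theorem cbond_src_apply (ρ : Fin P.d) (b : PBond P j) : (cbond ρ b).src ρ = -(b.tgt ρ) - 1 := by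
  obtain ⟨s, μ⟩ := b
  simp only [cbond, PBond.translate_src, PBond.reflect, PBond.tgt, Site.add_apply, zero_unshift_apply, if_true]
  by_cases h : μ = ρ
  · subst h
    simp only [if_true, Site.reflect_apply, Site.shift_apply]
    ring
  · rw [if_neg h, Site.reflect_apply, if_pos rfl, Site.shift_apply, if_neg (Ne.symm h)]
    ring

/-- the `ρ`-label of the target of `cbond ρ b` is the reflected `ρ`-label of the SOURCE of `b`. [folklore] -/
theorem cbond_tgt_apply (ρ : Fin P.d) (b : PBond P j) : (cbond ρ b).tgt ρ = -(b.src ρ) - 1 := by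
  have hsrc := cbond_src_apply ρ b
  obtain ⟨s, μ⟩ := b
  simp only [PBond.tgt, cbond_dir] at hsrc ⊢
  by_cases h : μ = ρ
  · subst h
    rw [Site.shift_apply, if_pos rfl, hsrc, Site.shift_apply, if_pos rfl]
    ring
  · rw [Site.shift_apply, if_neg (Ne.symm h), hsrc, Site.shift_apply, if_neg (Ne.symm h)]

/-- labels of the endpoints of `cbond ρ b`. [folklore] -/
theorem val_cbond (ρ : Fin P.d) (b : PBond P j) :
    ((cbond ρ b).src ρ).val = P.sitesPerDir j - 1 - (b.tgt ρ).val ∧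
      ((cbond ρ b).tgt ρ).val = P.sitesPerDir j - 1 - (b.src ρ).val := by
  rw [cbond_src_apply, cbond_tgt_apply, AveragingReflection.val_neg_sub_one, AveragingReflection.val_neg_sub_one]
  exact ⟨rfl, rfl⟩

/-- **`cbond` MAPS CROSSING BONDS TO CROSSING BONDS.** [folklore] -/
theorem cbond_mem_crossBonds (ρ : Fin P.d) (b : PBond P j) : cbond ρ b ∈ crossBonds P j ρ ↔ b ∈ crossBonds P j ρ := by
  rw [mem_crossBonds, mem_crossBonds, (val_cbond ρ b).1, (val_cbond ρ b).2]
  have h1 := ZMod.val_lt (b.src ρ)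
  have h2 := ZMod.val_lt (b.tgt ρ)
  have h3 := two_mul_half_sitesPerDir P j
  omega

/-- `cbond` maps positive bonds to NEGATIVE bonds (both endpoints outside the positive half) and conversely. [folklore] -/
theorem cbond_mem_posBonds (ρ : Fin P.d) (b : PBond P j) :
    cbond ρ b ∈ posBonds P j ρ ↔
      ¬ (b.src ρ).val < P.sitesPerDir j / 2 ∧ ¬ (b.tgt ρ).val < P.sitesPerDir j / 2 := by
  rw [mem_posBonds, (val_cbond ρ b).1, (val_cbond ρ b).2]
  have h1 := ZMod.val_lt (b.src ρ)
  have h2 := ZMod.val_lt (b.tgt ρ)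
  have h3 := two_mul_half_sitesPerDir P j
  omega

/-- **`cbond` IS AN INVOLUTION.** [folklore] -/
theorem cbond_cbond (ρ : Fin P.d) (b : PBond P j) : cbond ρ (cbond ρ b) = b := by
  obtain ⟨s, μ⟩ := b
  simp only [cbond, PBond.translate, PBond.reflect, PBond.mk.injEq, and_true]
  funext ν
  by_cases h : μ = ρ
  · subst h
    simp only [if_true, Site.add_apply, zero_unshift_apply, Site.reflect_apply, Site.shift_apply]
    split_ifs with hν
    · subst hν; ring
    · ring
  · simp only [if_neg h, Site.add_apply, zero_unshift_apply, Site.reflect_apply]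
    split_ifs with hν
    · subst hν; ring
    · ring

variable {G : Type*} [GaugeGroup G]

/-- **THE CENTRE REFLECTION OF FIELDS, EVALUATED**: `(c_ρ U)(b) = U(c_ρ b)^{∓1}` (the reflected `ρ`-bond is traversed
backwards). [folklore] -/
theorem creflect_apply (ρ : Fin P.d) (U : GaugeField P j G) (b : PBond P j) :
    U.creflect ρ b = if b.dir = ρ then (U (cbond ρ b))⁻¹ else U (cbond ρ b) := rfl

/-- **THE CENTRE REFLECTION OF FIELDS IS AN INVOLUTION.** [folklore] -/
theorem creflect_creflect (ρ : Fin P.d) (U : GaugeField P j G) : (U.creflect ρ).creflect ρ = U := by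
  funext b
  rw [creflect_apply, creflect_apply, cbond_dir]
  by_cases h : b.dir = ρ
  · rw [if_pos h, if_pos h, cbond_cbond, inv_inv]
  · rw [if_neg h, if_neg h, cbond_cbond]

/-- `c_ρ ∘ c_ρ = id` on fields (W3b's binder shape `θ ∘ θ = id`). [folklore] -/
theorem creflect_comp_self (ρ : Fin P.d) :
    (GaugeField.creflect (P := P) (j := j) (G := G) ρ) ∘ GaugeField.creflect ρ = id :=
  funext (creflect_creflect ρ)

/-- The centre reflection of fields is measurable (W3b's binder `Measurable θ`). [folklore] -/
theorem measurable_creflect [MeasurableSpace G] [MeasurableInv G] (ρ : Fin P.d) :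
    Measurable (GaugeField.creflect (P := P) (j := j) (G := G) ρ) := by
  refine measurable_pi_lambda _ fun b => ?_
  by_cases h : b.dir = ρ
  · simp only [creflect_apply, h, if_true]
    exact (measurable_pi_apply _).inv
  · simp only [creflect_apply, h, if_false]
    exact measurable_pi_apply _

end Geometry

/-! ## §1 The positive σ-algebra and the measurability criterion -/

section Sigma

variable (G : Type*) [MeasurableSpace G]

/-- **THE POSITIVE σ-ALGEBRA** of direction `ρ` at level `j`: the events of the fine field depending only on the
positive bonds (Mathlib's `Filtration.piFinset`, as in W3c's `piFinset posEdges`). [folklore] -/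
abbrev mPos (j : ℕ) (ρ : Fin P.d) : MeasurableSpace (GaugeField P j G) :=
  (Filtration.piFinset (X := fun _ : PBond P j => G) (posBonds P j ρ) : MeasurableSpace (PBond P j → G))

/-- `mPos ≤` the product σ-algebra (W3b's binder `mP ≤ m`). [folklore] -/
theorem mPos_le (j : ℕ) (ρ : Fin P.d) : mPos G j ρ ≤ (inferInstance : MeasurableSpace (GaugeField P j G)) :=
  (Filtration.piFinset (X := fun _ : PBond P j => G)).le _

/-- the restriction to the positive bonds is `mPos`-measurable (definition of `piFinset`). [folklore] -/
theorem measurable_restrict_mPos (j : ℕ) (ρ : Fin P.d) :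
    Measurable[mPos G j ρ] ((posBonds P j ρ).restrict : GaugeField P j G → (↥(posBonds P j ρ) → G)) :=
  measurable_iff_comap_le.2 le_rfl

/-- **MEASURABILITY CRITERION**: a measurable function of the fine field that depends only on the positive bonds is
`mPos`-measurable (factor through `Function.updateFinset 1 posBonds ∘ restrict`). [folklore] -/
theorem measurable_mPos_of_dependsOn [GaugeGroup G] {α : Type*} [MeasurableSpace α] {ρ : Fin P.d}
    {F : GaugeField P j G → α}
    (hF : Measurable F) (hdep : DependsOn F ((posBonds P j ρ : Finset (PBond P j)) : Set (PBond P j))) :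
    Measurable[mPos G j ρ] F := by
  classical
  have hfac : F = (fun w : ↥(posBonds P j ρ) → G =>
      F (Function.updateFinset (fun _ : PBond P j => (1 : G)) (posBonds P j ρ) w)) ∘ (posBonds P j ρ).restrict := by
    funext U
    refine hdep fun b hb => ?_
    have hb' : b ∈ posBonds P j ρ := Finset.mem_coe.1 hb
    simp [Function.updateFinset, hb']
  rw [hfac]
  exact (hF.comp measurable_updateFinset).comp (measurable_restrict_mPos G j ρ)

end Sigma

end

end Summit.QuantumFields.BalabanUV.T4Continuum.HistoryRPHalfTorus
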